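import Summits.CriticalPhenomena.CardyFormulaZ2.Theses.UnionJackBeffara

/-!
# Assembly of route `UnionJackBeffara` (sub-problem `CardyFormulaZ2`)

Item `stmt-CriticalPhenomena-4562`: the assembly statement
`UnionJackMorera → UnionJackEndgame → MixedInterpolation → CoveringBridge → CardyFormulaZ2`
of the route `route-CriticalPhenomena-UnionJackBeffara`.  It is `Tendsto` arithmetic over the
route's own decls: `UnionJackEndgame` applied to `UnionJackMorera` gives Cardy's formula for the
crude `P_{1/2,1/2}` site crossing of every conformal rectangle on `δG_s`; subtracting the
`o(1)` difference `MixedInterpolation` (`P_{1/2,1/2} - P_{1/2,0} → 0`) gives the same limit for the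
crude `P_{1/2,0}` crossing of every conformal rectangle, which is verbatim the antecedent of
`CoveringBridge`, whose conclusion is `CardyFormulaZ2`.  This is exactly the body of the route's
deciding theorem `UnionJackBeffara.closes`.
-/

namespace Summit.CriticalPhenomena.CardyFormulaZ2.Theorems

open Filter Topology
open Summit.CriticalPhenomena.CardyFormulaZ2.Theses

/-- **Assembly of the `UnionJackBeffara` route** (item `stmt-CriticalPhenomena-4562`):
the four route hypotheses `UnionJackMorera`, `UnionJackEndgame`, `MixedInterpolation`,
`CoveringBridge` imply `CardyFormulaZ2`.  `CoveringBridge` reduces the goal to the crude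
`P_{1/2,0}` crossing limit of every conformal rectangle `R`; for a uniformizing datum `(φ, x)` of
`R`, `UnionJackEndgame hM` gives `P_{1/2,1/2}(R, δ) → F(η)` and `MixedInterpolation` gives
`P_{1/2,1/2}(R, δ) - P_{1/2,0}(R, δ) → 0`, so their difference `P_{1/2,0}(R, δ) → F(η) - 0`
(the same term as the route's deciding theorem `UnionJackBeffara.closes`). -/
theorem unionJackBeffara_assembly_proof : UnionJackBeffara.Assembly := by
  unfold UnionJackBeffara.Assembly
  intro hM hE hI hB
  apply hB
  intro R φ x hx
  have h1 := hE hM R φ x hx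
  have h2 := hI R
  have h3 := h1.sub h2
  simp only [sub_sub_cancel, sub_zero] at h3
  exact h3

end Summit.CriticalPhenomena.CardyFormulaZ2.Theorems
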